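import Summits.HodgeConjecture.HodgeConjecture.Theses.FiniteTreeOfFlavours
import Literature.AlgebraicGeometry.Motives.UniversalHypersurfaceFibre
import Literature.AlgebraicGeometry.Motives.GeneralNonsingularForms
import Literature.AlgebraicGeometry.Motives.FermatHypersurface
import Literature.AlgebraicGeometry.HodgeTheory.HodgeLocus
import Literature.AlgebraicGeometry.HodgeTheory.IsoTransport
import Literature.AlgebraicGeometry.HodgeTheory.HypersurfaceJacobian
import Literature.AlgebraicGeometry.HodgeTheory.UniversalHypersurfaceHodgeLoci

/-!
# Birth skeleton (BC3) of the crux `RigidImpliesQbar` (stmt-HodgeConjecture-1494),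
# route `FiniteTreeOfFlavours` — line `birth`: "the Hodge locus of a rigid class is a finite union
# of `GL`-orbits defined over `ℚ̄`, hence has a `ℚ̄`-point"

The crux (rank 4 of the route; VERBATIM the route decl
`Summit.HodgeConjecture.HodgeConjecture.Theses.FiniteTreeOfFlavours.RigidImpliesQbar`): if a smooth
hypersurface `X ⊂ ℙⁿ⁺¹_ℂ` of degree `d` carries a rational `(k,k)`-class `c` that does NOT MOVE (no
smooth projective `(n+1)`-fold over a smooth projective curve has `X` as a fibre, only finitely many
fibres `≅ X`, and a rational `(k,k)`-class restricting to `c`), then `X ≅ V₊(F)` for a form `F` of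
degree `d` with algebraic coefficients. It is the residual POINT case of Klingler–Otwinowska–Urbanik,
Conj. 1.5 / Cor. 1.14 (special points of `ℤ`VHS are defined over `ℚ̄`), here for the universal
family of smooth hypersurfaces.

## The line (three stubs, one heart)

Everything is moved onto the REAL universal family `π = UniversalHypersurface.family ℂ n d : 𝒴_U → U`
(`Motives/UniversalHypersurfaceFamily`, Voisin II §6.2.1; `U(ℂ) = ComplexPoints (base ℂ n d)` = the
nonsingular forms, a point `t` having the form `pointForm ℂ n d t` and the fibre `Y_t ≅ X_{F_t}`) and
onto the tree's real-carrier Hodge loci (`HodgeTheory/HodgeLocus`: `hodgeLocusOfClass π n k (s, α)` =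
the image in `U(ℂ)` of the connected component through `(s, α)` of the locus of rational
`(k,k)`-classes, in the étalé topology of `R²ᵏπ_*ℂ` — Voisin 2007 §1, Cattani–Deligne–Kaplan §1).
Every smooth `(n,d)`-hypersurface is a fibre `X ≅ Y_s` (PROVED here, `exists_iso_fiberOver_family`:
Jacobian criterion + `𝒴_{[F]} ≅ X_F`), and `c` becomes `α = (e⁻¹)^* c` on `Y_s`.

* STUB G `stub_hodgeLocus_subset_isoLocus_of_rigid` (GEOMETRY; known in print, L–XL): if `c` is
  rigid then the Hodge locus `Z` of `(s, α)` lies in the isomorphism locus `{t | Y_t ≅ X}` — "rigid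
  ⟹ zero-dimensional modulo `GL_{n+2}`", the direction "positive-dimensional Hodge locus ⟹ the class
  moves" of the route thesis: CDK algebraicity of the locus of Hodge classes, closed `GL`-orbits of
  equal dimension for `d ≥ 3` (GIT stability of smooth hypersurfaces), a curve in a component through
  `(s, α)` leaving the orbit, compactification + resolution, and Deligne's global invariant cycle
  theorem (Voisin II Thm. 4.24) + semisimplicity of polarisable Hodge structures to lift the flat
  Hodge section to a Hodge class `Λ` on the total space.
* STUB H `stub_isolated_hodgeLocus_qbarClosed` (THE HEART; open): if the Hodge locus `Z` of a
  rational `(k,k)`-class `α` on `Y_s` lies in the isomorphism locus of `Y_s`, then `Z` is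
  `ℚ̄`-CLOSED: Zariski closed on points and stable under every automorphism of `ℂ` fixing `ℚ̄`
  (acting on `U(ℂ)` through coefficients, `conjPt`). Known when `α` is (weakly) absolute Hodge
  (Voisin 2007, Lemma 1.4 — arXiv: Lemma 2.4 —: the component of the locus of Hodge classes through a
  weakly absolute Hodge class, hence its Hodge locus, is defined over `ℚ̄`; Charles–Schnell
  Thm. 11.3.17) and for CM points of Shimura-type families; open in general = KOU's point case (Voisin's
  criterion Thm. 0.5 needs a positive-dimensional component). This is where bi-algebraic /
  Ax–Schanuel / absolute-Hodge tools enter.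
* STUB A `stub_qbarClosed_has_algebraic_point` (ARITHMETIC DESCENT; known, M–L): a non-empty
  `ℚ̄`-closed subset of `U(ℂ)` contains a point all of whose coefficients are algebraic (Weil–Lang:
  a closed set stable under `Aut(ℂ/ℚ̄)` is cut out by equations over `ℚ̄`, Lang III §5 C4 ⟺ C7, the
  fixed field of `Aut(ℂ/ℚ̄)` being `ℚ̄`; then Hilbert's Nullstellensatz over `ℚ̄` and density of
  `ℚ̄`-points in the open part `Z = W ∩ U`).
* `RigidImpliesQbar_of` — the kernel-checked composition G → H → A → the crux BY NAME (real proof: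
  `X ≅ Y_s`; transport of rationality / Hodge type along `e` (`IsoTransport`); `s ∈ Z`; A gives an
  algebraic `t ∈ Z`; G gives `Y_t ≅ X`; conclude with `F = pointForm t`, homogeneous of degree `d`,
  cutting out `X_{F} ≅ Y_t ≅ X`); `RigidImpliesQbar_granted_stubs` — the crux modulo exactly the stubs.

Tightness of the cut (informal): the crux for `Y_s` gives H back (each `GL`-orbit in `Z` then contains
a point with algebraic coefficients — for `(n,d) = (2,4)` via Néron–Severi descent of the other
quartic polarisations — and `τ(GL·t₀) = GL·t₀` for algebraic `t₀`), so H is the heart transferred to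
the field-of-definition language in which the partial results (Voisin 2007, KOU 2023, Saito–Schnell
arXiv:1408.2488) are stated; G and A are the two genuine transfers.

Disproof used: none on file (`Cruxes/RigidImpliesQbar/` had no workfiles, no `Disproof.lean`, no
`_false_without_` theorem and no Negative lemma at registration; `ledger negatives --problem
HodgeConjecture` lists 3 refuted statements, none about hypersurface moduli, Hodge loci or fields of
definition).

## References

* [KlinglerOtwinowskaUrbanik2023] Conj. 1.5, Cor. 1.13, Cor. 1.14.
* [Voisin2007HodgeLoci] §0 Prop. 0.2, Thm. 0.5, Cor. 0.6; §1 Def. 1.1, Thm. 1.3 (= CDK), Lemma 1.4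
  (arXiv math/0605766 numbering: 1.2, 1.5, 1.6; 2.1, 2.3, 2.4).
* [CharlesSchnell2014Notes] §11.3.3 Def. 11.3.9–11.3.10; §11.3.5 Thm. 11.3.17, 11.3.19.
* [CattaniDeligneKaplan1995JAMS] Thm. 1.1, Cor. 1.2 (algebraicity of the locus of Hodge classes).
* [DeligneHodgeII1971] Thm. 4.1.1 (global invariant cycles; = [VoisinHodgeII2003] §4.3.3 Thm. 4.24, Cor. 4.25).
* [MumfordFogartyKirwan1994] Ch. 4 §2, Prop. 4.2 (smooth hypersurfaces of degree `≥ 3` are stable).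
* [Lang1958IAG] Ch. III §5, conditions C4–C7 (`k₀`-closed sets); [Hartshorne1977] I Thm. 1.3A,
  I Ex. 5.8, II Ex. 3.11 (d).
* [VoisinHodgeII2003] §5.3.1, §6.2.1 (the universal smooth hypersurface).
* M. Saito, C. Schnell, Fields of definition of Hodge loci, arXiv:1408.2488.
-/

noncomputable section

namespace Summit.HodgeConjecture.HodgeConjecture.Cruxes.RigidImpliesQbar.Birth

open CategoryTheory
open Literature.AlgebraicGeometry.Motives Literature.AlgebraicGeometry.HodgeTheory
open Literature.AlgebraicGeometry.Motives.UniversalHypersurface (base family pointForm pointOfForm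
  isHomogeneous_pointForm isNonsingularForm_pointForm)
open Summit.HodgeConjecture.HodgeConjecture.Theses.FiniteTreeOfFlavours (RigidImpliesQbar)

/-! ### Local vocabulary (three abbreviations over tree declarations) -/

/-- `c ∈ H²ᵏ(X(ℂ); ℂ)` **moves** — VERBATIM the existential of the route's cruxes
(`MovableClassesAlgebraic`, `RigidImpliesQbar`, `RigidQbarClassesAlgebraic`): `c` is the restriction
of a rational `(k,k)`-class `Λ` on a smooth projective `(n+1)`-fold `𝒴 → C` over a smooth projective
curve having `X` as the fibre over `t` and only finitely many fibres `≅ X`. `¬ Moves n X k c` is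
definitionally the rigidity hypothesis of the crux. [cite: BaldiKlinglerUllmo2024, §2 (movable vs. atypical of zero period dimension, p. 5)] -/
def Moves (n : ℕ) (X : SchemeOver ℂ) (k : ℕ) (c : complexBetti X (2 * k)) : Prop :=
  ∃ (𝒴 C : SchemeOver ℂ) (π : 𝒴 ⟶ C) (t : AlgPoints C ℂ) (e : X ≅ fiberOver π t)
    (Λ : complexBetti 𝒴 (2 * k)),
    IsSmoothProjective (n + 1) 𝒴 ∧ IsSmoothProjective 1 C ∧ IsRationalClass Λ ∧
      IsOfHodgeType (n + 1) 𝒴 (2 * k) k k Λ ∧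
      (complexBetti.map (e.hom ≫ fiberι π t) (2 * k)).hom Λ = c ∧
      Set.Finite {t' : AlgPoints C ℂ | Nonempty (fiberOver π t' ≅ X)}

/-- The action of a field automorphism `τ` of `ℂ` on the parameter space `U(ℂ)` of smooth
hypersurfaces of degree `d` in `ℙⁿ⁺¹_ℂ` THROUGH THE COEFFICIENTS: `t ↦ [τ(F_t)]`, the point of the
form `τ(F_t)` (homogeneous of degree `d` and nonsingular again: `IsHomogeneous.map`,
`IsNonsingularForm.map`; the point exists by `pointOfForm`). This is Lang's `x ↦ x^τ` on
`U(ℂ) ⊆ ℂ^{#monomials}` (III §4) and Voisin's `τ` acting on the base of a family defined over `ℚ`.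
[cite: Lang1958IAG, Ch. III §4] [cite: Voisin2007HodgeLoci, §1 Lemma 1.4] -/
def conjPt {n d : ℕ} (τ : ℂ ≃+* ℂ) (t : ComplexPoints (base ℂ n d)) : ComplexPoints (base ℂ n d) :=
  pointOfForm ℂ n d ((isHomogeneous_pointForm ℂ n d t).map τ.toRingHom)
    ((isNonsingularForm_pointForm ℂ n d t).map τ.toRingHom)

/-- `Z ⊆ U(ℂ)` is **`ℚ̄`-closed** (Weil's `ℚ̄`-closed sets; Lang III §5, C4/C5: "`A^τ = A` for every
automorphism `τ` of `Ω` over `k₀`", `Ω = ℂ`, `k₀ = ℚ̄`): Zariski closed on points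
(`Motives.IsZariskiClosedOnPoints`, the tree's carrier for "algebraic subset of `U(ℂ)`") and stable
under every automorphism of `ℂ` fixing the algebraic numbers pointwise, acting through `conjPt`. The
tree's `HodgeTheory.IsDefinedOverQbar σ S₀` is the same notion for a base presented as a base change
`S₀ ⊗_{K,σ} ℂ`; `U = base ℂ n d` is not literally of that shape, whence this direct spelling.
[cite: Lang1958IAG, Ch. III §5, C4–C7] [cite: Voisin2007HodgeLoci, Lemma 1.4 (arXiv math/0605766: Lemma 2.4)] -/
def IsQbarClosed {n d : ℕ} (Z : Set (ComplexPoints (base ℂ n d))) : Prop :=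
  IsZariskiClosedOnPoints (base ℂ n d) Z ∧
    ∀ τ : ℂ ≃+* ℂ, (∀ z : ℂ, IsAlgebraic ℚ z → τ z = z) → ∀ t ∈ Z, conjPt τ t ∈ Z

/-! ### The three registered stubs (`sorry` ONLY here) -/

/-- STUB G (GEOMETRY of rigid classes; known in print, L–XL to formalise) — **the Hodge locus of a
rigid class lies in the isomorphism locus.** Let `X` be a smooth `(n,d)`-hypersurface, `c` a rational
`(k,k)`-class on `X` that does not move, `e : X ≅ Y_s` an identification with a fibre of the universal
family, `α = (e⁻¹)^* c`. Then every point `t` of the Hodge locus of `(s, α)` (image in `U(ℂ)` of the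
connected component of the locus of Hodge classes through `(s, α)`) has `Y_t ≅ X`. In print: the
component `𝒞 ∋ (s, α)` is `GL_{n+2}(ℂ)`-stable and algebraic with finitely many irreducible
components, finite over its image (Cattani–Deligne–Kaplan Thm. 1.1 / Cor. 1.2, after scaling `α` to an
integral class; `Q(α,α)` and the denominator are constant on `𝒞`); for `d ≥ 3` the isomorphism locus
of `X` is a finite union of closed `GL`-orbits of dimension `dim GL` (GIT stability of smooth
hypersurfaces, MFK Prop. 4.2; isomorphic smooth hypersurfaces are projectively equivalent, up to
finitely many polarisations for `(2,4)`), for `d ≤ 2` or `n = 0` it is all of `U(ℂ)` (nothing to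
prove). If an irreducible component `𝒞₁ ∋ (s, α)` left the isomorphism locus, an irreducible curve
`B ⊂ 𝒞₁` through `(s, α)` meets it in finitely many points; restricting `π` to (the normalisation of)
`B`, compactifying and resolving away from the smooth fibres gives a smooth projective `(n+1)`-fold
over a smooth projective curve with `X ≅ Y_s` as a fibre and finitely many fibres `≅ X`, and the
tautological flat section `b ↦ α_b` (rational `(k,k)` along `B`) lifts to a rational `(k,k)`-class `Λ`
on the total space (Deligne's global invariant cycle theorem, Hodge II Thm. 4.1.1 = Voisin II Thm. 4.24 /
Cor. 4.25, + semisimplicity of polarisable Hodge structures) — so `c` moves,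
contradiction; components through `(s,α)` being single orbits, connectedness makes `𝒞 = GL·(s,α)`.
Why it might fail: only through the plumbing of the étalé topology (sections over `𝒞` are flat:
needs Ehresmann / proper base change, not yet in the tree) — the statement is implied by the route's
own thesis equivalence "moves ⟺ positive-dimensional Hodge locus mod `PGL`".
[cite: CattaniDeligneKaplan1995JAMS, Thm. 1.1 and Cor. 1.2] [cite: DeligneHodgeII1971, Thm. 4.1.1]
[cite: VoisinHodgeII2003, §4.3.3 Thm. 4.24 and Cor. 4.25]
[cite: MumfordFogartyKirwan1994, Ch. 4 §2 Prop. 4.2] [cite: Voisin2007HodgeLoci, §1] -/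
theorem stub_hodgeLocus_subset_isoLocus_of_rigid :
    ∀ ⦃n d : ℕ⦄ ⦃X : SchemeOver ℂ⦄, IsSmoothHypersurface n d X →
      ∀ (k : ℕ) (c : complexBetti X (2 * k)), IsRationalClass c → IsOfHodgeType n X (2 * k) k k c →
        ¬ Moves n X k c →
        ∀ (s : ComplexPoints (base ℂ n d)) (e : X ≅ fiberOver (family ℂ n d) s),
          hodgeLocusOfClass (family ℂ n d) n k ⟨s, (complexBetti.map e.inv (2 * k)).hom c⟩ ⊆
            {t | Nonempty (fiberOver (family ℂ n d) t ≅ X)} := by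
  sorry

/-- STUB H (THE HEART; open — Klingler–Otwinowska–Urbanik's point case in real-carrier form) — **an
isolated Hodge locus of the universal family of hypersurfaces is `ℚ̄`-closed.** For a rational
`(k,k)`-class `α` on a fibre `Y_s` whose Hodge locus `Z ⊆ U(ℂ)` lies in the isomorphism locus
`{t | Y_t ≅ Y_s}` (i.e. `Z` is a finite union of `GL_{n+2}(ℂ)`-orbits: "zero-dimensional modulo
`PGL`", an atypical point of zero period dimension in BKU's language), `Z` is Zariski closed on points
and stable under `Aut(ℂ/ℚ̄)` acting on coefficients. KNOWN CASES: `α` weakly absolute Hodge (Voisin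
2007 Lemma 1.4, arXiv Lemma 2.4: then the component of the locus of Hodge classes through `α`, hence
the Hodge locus of `α`, is defined over `ℚ̄` and its Galois conjugates are Hodge loci; Charles–Schnell
Thm. 11.3.17), in particular `α` algebraic or `Y_s` with CM by an abelian motive (Deligne, André);
Voisin's criterion Thm. 0.5 for weak absoluteness needs a POSITIVE-dimensional component, whence the
point case is open; positive-dimensional MAXIMAL special subvarieties are over `ℚ̄` unconditionally
(KOU Cor. 1.13) and a special subvariety is over `ℚ̄` iff it contains a `ℚ̄`-point (Saito–Schnell
arXiv:1408.2488). Degenerate instances hold: `d ≤ 2`, `n = 0`, `α ∈ ℚ·h^k` or `α = 0` force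
`Z = U(ℂ)` (`isZariskiClosedOnPoints_univ`, trivially stable). Why it might fail: false iff some
hypersurface with a transcendental modulus carries a rigid Hodge class (kill criterion K2 of the
route; it would refute the crux and the Hodge conjecture together) — e.g. a rigid non-absolute-Hodge
class at a non-CM point of `U_{n,d}`, about which "we can't say anything" (BKU p. 5).
[cite: KlinglerOtwinowskaUrbanik2023, Conj. 1.5 and Cor. 1.14] [cite: Voisin2007HodgeLoci, Lemma 1.4 and Thm. 0.5 (arXiv math/0605766: Lemma 2.4, Thm. 1.5)]
[cite: CharlesSchnell2014Notes, Thm. 11.3.17 and Thm. 11.3.19] [cite: BaldiKlinglerUllmo2024, §2 p. 5] -/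
theorem stub_isolated_hodgeLocus_qbarClosed :
    ∀ ⦃n d : ℕ⦄ (s : ComplexPoints (base ℂ n d)) (k : ℕ)
      (α : complexBetti (fiberOver (family ℂ n d) s) (2 * k)),
      IsRationalClass α → IsOfHodgeType n (fiberOver (family ℂ n d) s) (2 * k) k k α →
        hodgeLocusOfClass (family ℂ n d) n k ⟨s, α⟩ ⊆
          {t | Nonempty (fiberOver (family ℂ n d) t ≅ fiberOver (family ℂ n d) s)} →
        IsQbarClosed (hodgeLocusOfClass (family ℂ n d) n k ⟨s, α⟩) := by
  sorry

/-- STUB A (ARITHMETIC DESCENT; known, M–L to formalise) — **a non-empty `ℚ̄`-closed subset of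
`U(ℂ)` contains a point with algebraic coefficients.** `U = base ℂ n d` is the complexification of
the `ℚ`-scheme `base ℚ n d` (an open of the affine space of forms, coordinates `a_m` = the
coefficients, `coeff_pointForm`). A Zariski-closed `Z ⊆ U(ℂ)` stable under `Aut(ℂ/ℚ̄)` has its
closure `W ⊆ 𝔸(ℂ)` stable too, hence `I(W) ⊆ ℂ[a_m]` is `Aut(ℂ/ℚ̄)`-stable, hence generated by
`I(W) ∩ ℚ̄[a_m]` (descent of stable subspaces; the fixed field of `Aut(ℂ/ℚ̄)` is exactly `ℚ̄`, every
transcendental being moved) — Lang III §5, C4 ⟹ C7 in characteristic `0`; then `W` is a non-empty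
`ℚ̄`-variety, its `ℚ̄`-points are Zariski dense (Nullstellensatz over the algebraically closed `ℚ̄`,
Mathlib `MvPolynomial.zeroLocus_vanishingIdeal` engine), and the non-empty open part `Z = W ∩ U(ℂ)`
contains one: a `t` with `coeff m (pointForm t) ∈ ℚ̄` for all `m` (coefficients outside degree `d`
vanish). Why it might fail: it does not in print; in the tree the `Aut(ℂ/ℚ̄)`-descent of ideals and
the extension of automorphisms of `ℚ̄(S)` to `ℂ` (Zorn, transcendence bases: Mathlib
`IsTranscendenceBasis`, `IsAlgClosed.lift`) are the unbuilt pieces.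
[cite: Lang1958IAG, Ch. III §5, C4–C7 and Ch. III §4 Thm. 9] [cite: Hartshorne1977, I Thm. 1.3A] -/
theorem stub_qbarClosed_has_algebraic_point :
    ∀ ⦃n d : ℕ⦄ (Z : Set (ComplexPoints (base ℂ n d))), Z.Nonempty → IsQbarClosed Z →
      ∃ t ∈ Z, ∀ m, IsAlgebraic ℚ ((pointForm ℂ n d t).coeff m) := by
  sorry

/-! ### Proved plumbing for the composition -/

/-- An irreducible homogeneous form has positive degree (a degree-`0` form is `0` or a unit).
[folklore] -/
theorem pos_of_irreducible_isHomogeneous {n : ℕ} {F : MvPolynomial (Fin (n + 2)) ℂ} {d : ℕ}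
    (hF : F.IsHomogeneous d) (hirr : Irreducible F) : 0 < d := by
  rcases Nat.eq_zero_or_pos d with rfl | h
  · exfalso
    have h0 : F.totalDegree = 0 := Nat.le_zero.1 hF.totalDegree_le
    rw [MvPolynomial.totalDegree_eq_zero_iff_eq_C] at h0
    by_cases hc : F.coeff 0 = 0
    · rw [hc, map_zero] at h0
      exact not_irreducible_zero (h0 ▸ hirr)
    · exact hirr.not_isUnit (h0 ▸ (isUnit_iff_ne_zero.2 hc).map MvPolynomial.C)
  · exact h

/-- **Every smooth hypersurface over `ℂ` is a fibre of the universal family** `π : 𝒴_U → U` of smooth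
hypersurfaces of its dimension and degree: the form `F` cutting out `X` is nonsingular (Jacobian
criterion for the smooth projective `X = V₊(F)_red`, the tree's discharged
`Hartshorne1977_smoothHypersurface_jacobian_holds`, + the Nullstellensatz half
`isNonsingularForm_of_forall_exists_eval_pderiv_ne_zero`), so `[F] ∈ U(ℂ)` and
`𝒴_{[F]} ≅ X_F ≅ X` (`exists_fiberOver_iso_hypersurface`, uniqueness of the reduced induced
structure `IsHypersurfaceCutOutBy.nonempty_iso_hypersurface`). Also records `0 < d`.
[cite: Hartshorne1977, I Ex. 5.8 and II Ex. 3.11 (d)] [cite: VoisinHodgeII2003, §6.2.1] -/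
theorem exists_iso_fiberOver_family {n d : ℕ} {X : SchemeOver ℂ} (hX : IsSmoothHypersurface n d X) :
    0 < d ∧ ∃ s : ComplexPoints (base ℂ n d), Nonempty (X ≅ fiberOver (family ℂ n d) s) := by
  obtain ⟨hsp, F, hF, hirr, hcut⟩ := hX
  have hd : 0 < d := pos_of_irreducible_isHomogeneous hF hirr
  have hJ : SmoothHypersurface.IsNonsingularForm ℂ F :=
    SmoothHypersurface.isNonsingularForm_of_forall_exists_eval_pderiv_ne_zero
      (Hartshorne1977_smoothHypersurface_jacobian_holds n d X F hsp hF hirr hcut)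
  obtain ⟨s, ⟨e₁⟩⟩ := UniversalHypersurface.exists_fiberOver_iso_hypersurface ℂ n d hd hF hJ
  obtain ⟨e₂⟩ := hcut.nonempty_iso_hypersurface
  exact ⟨hd, s, ⟨e₂ ≪≫ e₁.symm⟩⟩

/-! ### The composition: stub G → stub H → stub A → the crux, by name -/

/-- **THE LINE'S COMPOSITION** (kernel-checked, no `sorry`): if the Hodge locus of a rigid class lies
in the isomorphism locus (G), an isolated Hodge locus is `ℚ̄`-closed (H), and non-empty `ℚ̄`-closed
subsets of `U(ℂ)` have points with algebraic coefficients (A), then a smooth hypersurface carrying a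
rigid rational `(k,k)`-class is `≅ V₊(F)` for a form `F` of degree `d` with algebraic coefficients.
Proof: `X ≅ Y_s` (`exists_iso_fiberOver_family`); `α = (e⁻¹)^* c` is rational of type `(k,k)`
(`isRationalClass_map_iff_of_iso`, `isOfHodgeType_map_iff_of_iso`), so `(s, α)` lies in the locus of
Hodge classes and `s` in its Hodge locus `Z`; G puts `Z` inside the isomorphism locus of `X`, hence of
`Y_s`; H makes `Z` `ℚ̄`-closed; A yields `t ∈ Z` with algebraic coefficients; G again gives `Y_t ≅ X`,
and `F = F_t` is homogeneous of degree `d` (`isHomogeneous_pointForm`) and cuts out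
`X_{F_t} ≅ Y_t ≅ X` (`isHypersurfaceCutOutBy_self`, `nonempty_fiberOver_iso_hypersurface`,
`IsHypersurfaceCutOutBy.of_iso`). [folklore] -/
theorem RigidImpliesQbar_of :
    (∀ ⦃n d : ℕ⦄ ⦃X : SchemeOver ℂ⦄, IsSmoothHypersurface n d X →
      ∀ (k : ℕ) (c : complexBetti X (2 * k)), IsRationalClass c → IsOfHodgeType n X (2 * k) k k c →
        ¬ Moves n X k c →
        ∀ (s : ComplexPoints (base ℂ n d)) (e : X ≅ fiberOver (family ℂ n d) s),
          hodgeLocusOfClass (family ℂ n d) n k ⟨s, (complexBetti.map e.inv (2 * k)).hom c⟩ ⊆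
            {t | Nonempty (fiberOver (family ℂ n d) t ≅ X)}) →
    (∀ ⦃n d : ℕ⦄ (s : ComplexPoints (base ℂ n d)) (k : ℕ)
      (α : complexBetti (fiberOver (family ℂ n d) s) (2 * k)),
      IsRationalClass α → IsOfHodgeType n (fiberOver (family ℂ n d) s) (2 * k) k k α →
        hodgeLocusOfClass (family ℂ n d) n k ⟨s, α⟩ ⊆
          {t | Nonempty (fiberOver (family ℂ n d) t ≅ fiberOver (family ℂ n d) s)} →
        IsQbarClosed (hodgeLocusOfClass (family ℂ n d) n k ⟨s, α⟩)) →
    (∀ ⦃n d : ℕ⦄ (Z : Set (ComplexPoints (base ℂ n d))), Z.Nonempty → IsQbarClosed Z →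
      ∃ t ∈ Z, ∀ m, IsAlgebraic ℚ ((pointForm ℂ n d t).coeff m)) →
    Summit.HodgeConjecture.HodgeConjecture.Theses.FiniteTreeOfFlavours.RigidImpliesQbar := by
  intro hG hH hA n d X hX k c hc hkk hrig
  obtain ⟨hd, s, ⟨e⟩⟩ := exists_iso_fiberOver_family hX
  have hαr : IsRationalClass ((complexBetti.map e.inv (2 * k)).hom c) :=
    (isRationalClass_map_iff_of_iso e.symm).2 hc
  have hαh : IsOfHodgeType n (fiberOver (family ℂ n d) s) (2 * k) k k
      ((complexBetti.map e.inv (2 * k)).hom c) :=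
    (isOfHodgeType_map_iff_of_iso e.symm).2 hkk
  have hZX : hodgeLocusOfClass (family ℂ n d) n k ⟨s, (complexBetti.map e.inv (2 * k)).hom c⟩ ⊆
      {t | Nonempty (fiberOver (family ℂ n d) t ≅ X)} :=
    hG hX k c hc hkk hrig s e
  have hZs : hodgeLocusOfClass (family ℂ n d) n k ⟨s, (complexBetti.map e.inv (2 * k)).hom c⟩ ⊆
      {t | Nonempty (fiberOver (family ℂ n d) t ≅ fiberOver (family ℂ n d) s)} :=
    fun t ht => (hZX ht).map fun i => i ≪≫ e
  have hcl := hH s k _ hαr hαh hZs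
  have hne : (hodgeLocusOfClass (family ℂ n d) n k
      ⟨s, (complexBetti.map e.inv (2 * k)).hom c⟩).Nonempty :=
    ⟨s, ⟨s, (complexBetti.map e.inv (2 * k)).hom c⟩,
      mem_connectedComponentIn (F := locusOfHodgeClasses (family ℂ n d) n k) ⟨hαr, hαh⟩, rfl⟩
  obtain ⟨t, htZ, halg⟩ := hA _ hne hcl
  obtain ⟨i⟩ := hZX htZ
  exact ⟨pointForm ℂ n d t, isHomogeneous_pointForm ℂ n d t, halg,
    (SmoothHypersurface.isHypersurfaceCutOutBy_self (pointForm ℂ n d t)).of_iso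
      ((UniversalHypersurface.nonempty_fiberOver_iso_hypersurface ℂ n d t hd).some.symm ≪≫ i)⟩

/-- **The crux, closed modulo exactly the three registered stubs.** -/
theorem RigidImpliesQbar_granted_stubs :
    Summit.HodgeConjecture.HodgeConjecture.Theses.FiniteTreeOfFlavours.RigidImpliesQbar :=
  RigidImpliesQbar_of stub_hodgeLocus_subset_isoLocus_of_rigid stub_isolated_hodgeLocus_qbarClosed
    stub_qbarClosed_has_algebraic_point

/-! ### Proved sanity: the trivial instance of A's input and the shape of H's degenerate case -/

/-- **All of `U(ℂ)` is `ℚ̄`-closed** (the value of the Hodge locus in every degenerate instance of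
STUB H: `d ≤ 2`, `n = 0`, `α ∈ ℚ·hᵏ`, `α = 0`). [folklore] -/
theorem isQbarClosed_univ (n d : ℕ) : IsQbarClosed (Set.univ : Set (ComplexPoints (base ℂ n d))) :=
  ⟨isZariskiClosedOnPoints_univ _, fun _ _ _ _ => Set.mem_univ _⟩

/-- **The form of a conjugated point is the conjugated form**: `F_{τ·t} = τ(F_t)`. [folklore] -/
theorem pointForm_conjPt {n d : ℕ} (τ : ℂ ≃+* ℂ) (t : ComplexPoints (base ℂ n d)) :
    pointForm ℂ n d (conjPt τ t) = MvPolynomial.map τ.toRingHom (pointForm ℂ n d t) :=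
  UniversalHypersurface.pointForm_pointOfForm ℂ n d _ _

/-- **Points with algebraic coefficients are fixed by `Aut(ℂ/ℚ̄)`** (the easy direction behind STUBS
H/A: an orbit `GL·t₀` with `t₀` algebraic is `τ`-stable). [folklore] -/
theorem conjPt_eq_self_of_isAlgebraic {n d : ℕ} (τ : ℂ ≃+* ℂ)
    (hτ : ∀ z : ℂ, IsAlgebraic ℚ z → τ z = z) (t : ComplexPoints (base ℂ n d))
    (ht : ∀ m, IsAlgebraic ℚ ((pointForm ℂ n d t).coeff m)) : conjPt τ t = t := by
  apply UniversalHypersurface.pointForm_injective ℂ n d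
  rw [pointForm_conjPt]
  ext m
  rw [MvPolynomial.coeff_map]
  exact hτ _ (ht m)

end Summit.HodgeConjecture.HodgeConjecture.Cruxes.RigidImpliesQbar.Birth

end
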